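import Mathlib
import HarnessLib
import Summits.AnomalousDissipation.AnomalousDissipation.Theorems.MarginalStabilityChainStrainedLayerLawStubCoreFloor

/-! # Stub `stub_cesaroMean` of the line `FirstLemmasR2K4` (crux stmt-AnomalousDissipation-3007
`MarginalStabilityChain.StrainedLayerLaw`, parallel-relaxation package)

Cesàro means in `ℝ≥0∞`: if `d : ℝ → ℝ` is nonnegative, bounded by `M` on `(0, ∞)` and `d t → K` as
`t → ∞`, then `liminf_T ofReal T⁻¹ · ∫⁻_{(0,T]} ofReal (d t) = ofReal K`. No measurability of `d` is
needed: the lower integral is monotone for arbitrary integrands (`setLIntegral_mono'` only asks for a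
measurable *set*), `lintegral_union_le` needs nothing, and constants integrate exactly.

Route:
* lower bound: for `ε > 0` eventually `ofReal (K - ε) ≤ ofReal (d t)`, so the tree lemma
  `le_liminf_cesaro_of_floor` gives `ofReal (K - ε) ≤ liminf`, and `ε → 0`
  (`ENNReal.le_of_forall_pos_le_add`);
* upper bound: for `ε > 0` pick `T₁ > 0` with `d t ≤ K + ε` for `t ≥ T₁`; for `T ≥ T₁` split
  `(0, T] = (0, T₁] ∪ (T₁, T]`, bound the two pieces by `M T₁` and `(K + ε)(T - T₁)`, so the Cesàro mean
  is at most `T⁻¹ (M T₁ + (K + ε)(T - T₁)) → K + ε`, whence `liminf ≤ ofReal (K + ε)`, and `ε → 0`.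
-/

set_option linter.dupNamespace false

noncomputable section

open scoped Topology ENNReal
open Filter Set MeasureTheory

namespace Summit.AnomalousDissipation.AnomalousDissipation.Theorems.StrainedLayerLaw.ParallelRelax

open Summit.AnomalousDissipation.AnomalousDissipation.Theorems.StrainedLayerLaw.ContractionCapture

/-- **Cesàro transfer of a late-time ceiling.** If `D t ≤ ofReal M` for all `t > 0` and
`D t ≤ ofReal C` for all `t ≥ T₁ > 0` (`M, C ≥ 0`), then `liminf_T T⁻¹ ∫⁻_{(0,T]} D ≤ ofReal C`:
indeed `T⁻¹ ∫⁻_{(0,T]} D ≤ T⁻¹ (M T₁ + C (T - T₁)) → C`. [folklore] -/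
theorem liminf_cesaro_le_of_ceiling {D : ℝ → ℝ≥0∞} {C M T₁ : ℝ} (hT₁ : 0 < T₁) (hM : 0 ≤ M)
    (hC : 0 ≤ C) (h0 : ∀ t : ℝ, 0 < t → D t ≤ ENNReal.ofReal M)
    (h : ∀ t : ℝ, T₁ ≤ t → D t ≤ ENNReal.ofReal C) :
    liminf (fun T : ℝ => ENNReal.ofReal T⁻¹ * ∫⁻ t in Ioc 0 T, D t) atTop ≤ ENNReal.ofReal C := by
  have hg : Tendsto (fun T : ℝ => ENNReal.ofReal (T⁻¹ * (M * T₁ + C * (T - T₁)))) atTop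
      (𝓝 (ENNReal.ofReal C)) := by
    refine ENNReal.tendsto_ofReal ?_
    have h1 : Tendsto (fun T : ℝ => (M * T₁ - C * T₁) * T⁻¹ + C) atTop
        (𝓝 ((M * T₁ - C * T₁) * 0 + C)) :=
      (tendsto_inv_atTop_zero.const_mul _).add tendsto_const_nhds
    rw [mul_zero, zero_add] at h1
    refine h1.congr' ?_
    filter_upwards [eventually_gt_atTop 0] with T hT
    field_simp
    ring
  rw [← hg.liminf_eq]
  refine liminf_le_liminf ?_
  filter_upwards [eventually_ge_atTop T₁] with T hT
  have hT0 : 0 < T := hT₁.trans_le hT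
  calc ENNReal.ofReal T⁻¹ * ∫⁻ t in Ioc 0 T, D t
      = ENNReal.ofReal T⁻¹ * ∫⁻ t in Ioc 0 T₁ ∪ Ioc T₁ T, D t := by
        rw [Ioc_union_Ioc_eq_Ioc hT₁.le hT]
    _ ≤ ENNReal.ofReal T⁻¹ * ((∫⁻ t in Ioc 0 T₁, D t) + ∫⁻ t in Ioc T₁ T, D t) := by
        gcongr
        exact lintegral_union_le _ _ _
    _ ≤ ENNReal.ofReal T⁻¹ *
          ((∫⁻ _ in Ioc 0 T₁, ENNReal.ofReal M) + ∫⁻ _ in Ioc T₁ T, ENNReal.ofReal C) := by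
        gcongr ENNReal.ofReal T⁻¹ * (?_ + ?_)
        · exact setLIntegral_mono' measurableSet_Ioc fun t ht => h0 t ht.1
        · exact setLIntegral_mono' measurableSet_Ioc fun t ht => h t ht.1.le
    _ = ENNReal.ofReal (T⁻¹ * (M * T₁ + C * (T - T₁))) := by
        rw [setLIntegral_const, setLIntegral_const, Real.volume_Ioc, Real.volume_Ioc, sub_zero,
          ← ENNReal.ofReal_mul hM, ← ENNReal.ofReal_mul hC,
          ← ENNReal.ofReal_add (by positivity) (by nlinarith),
          ← ENNReal.ofReal_mul (inv_nonneg.2 hT0.le)]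

/-- **Stub `stub_cesaroMean`.** Cesàro means in `ℝ≥0∞` of a nonnegative function bounded on `(0, ∞)`
with a limit `K` at `∞`: `liminf_T ofReal T⁻¹ · ∫⁻_{(0,T]} ofReal (d t) = ofReal K` (lower bound from
`le_liminf_cesaro_of_floor`, upper bound from `liminf_cesaro_le_of_ceiling`, then `ε → 0`). [folklore] -/
theorem stub_cesaroMean :
    ∀ (d : ℝ → ℝ) (K M : ℝ), 0 ≤ K → (∀ t, 0 ≤ d t) → (∀ t, 0 < t → d t ≤ M) →
      Tendsto d atTop (𝓝 K) →
        Filter.liminf (fun T : ℝ => ENNReal.ofReal T⁻¹ * ∫⁻ t in Set.Ioc 0 T, ENNReal.ofReal (d t))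
          Filter.atTop = ENNReal.ofReal K := by
  intro d K M hK hd hM hlim
  have hM0 : 0 ≤ M := (hd 1).trans (hM 1 one_pos)
  rw [Metric.tendsto_atTop] at hlim
  refine le_antisymm ?_ ?_
  · -- upper bound: `liminf ≤ ofReal K`
    refine ENNReal.le_of_forall_pos_le_add fun ε hε _ => ?_
    have hε' : (0 : ℝ) < ε := hε
    obtain ⟨T₁, hT₁⟩ := hlim ε hε'
    have hceil : ∀ t : ℝ, max T₁ 1 ≤ t → ENNReal.ofReal (d t) ≤ ENNReal.ofReal (K + ε) := by
      intro t ht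
      have hdist := hT₁ t ((le_max_left T₁ 1).trans ht)
      rw [Real.dist_eq, abs_lt] at hdist
      exact ENNReal.ofReal_le_ofReal (by linarith)
    calc liminf (fun T : ℝ => ENNReal.ofReal T⁻¹ * ∫⁻ t in Set.Ioc 0 T, ENNReal.ofReal (d t)) atTop
        ≤ ENNReal.ofReal (K + ε) :=
          liminf_cesaro_le_of_ceiling (lt_of_lt_of_le one_pos (le_max_right T₁ 1)) hM0
            (by positivity) (fun t ht => ENNReal.ofReal_le_ofReal (hM t ht)) hceil
      _ = ENNReal.ofReal K + ε := by
          rw [ENNReal.ofReal_add hK hε'.le, ENNReal.ofReal_coe_nnreal]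
  · -- lower bound: `ofReal K ≤ liminf`
    refine ENNReal.le_of_forall_pos_le_add fun ε hε _ => ?_
    have hε' : (0 : ℝ) < ε := hε
    obtain ⟨T₂, hT₂⟩ := hlim ε hε'
    have hfloor : ∀ t : ℝ, max T₂ 0 ≤ t → ENNReal.ofReal (K - ε) ≤ ENNReal.ofReal (d t) := by
      intro t ht
      have hdist := hT₂ t ((le_max_left T₂ 0).trans ht)
      rw [Real.dist_eq, abs_lt] at hdist
      exact ENNReal.ofReal_le_ofReal (by linarith)
    calc ENNReal.ofReal K = ENNReal.ofReal ((K - ε) + ε) := by rw [sub_add_cancel]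
      _ ≤ ENNReal.ofReal (K - ε) + ENNReal.ofReal ε := ENNReal.ofReal_add_le
      _ ≤ liminf (fun T : ℝ => ENNReal.ofReal T⁻¹ * ∫⁻ t in Set.Ioc 0 T, ENNReal.ofReal (d t)) atTop
            + ε := by
          rw [ENNReal.ofReal_coe_nnreal]
          gcongr
          exact le_liminf_cesaro_of_floor (le_max_right T₂ 0) hfloor

end Summit.AnomalousDissipation.AnomalousDissipation.Theorems.StrainedLayerLaw.ParallelRelax

end
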